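import Mathlib
import HarnessLib

/-!
# Seed crux `SignedMuSeedAtTwoPlus` (stmt-BirchSwinnertonDyer-21438), line `norm-field-tilt`:
# the `s̄`-DIGITS — uniqueness below `t^e`, and «an odd digit ⟹ not a square in the bottom ring» (S1 (iv), algebraic half)

Cell `bsd-wall`, width seat `bsd-wall-rtt-p4-w2` g10; seventh file on the line's algebra (independent of the others).
HONEST FRAMING: THEOREMS ONLY; pure algebra over an integral domain (of characteristic `2` for the square lemma);
closes no item; the line is NOT registered; BSD is NOT proved by this.

## What is proved

In the line, the bottom ring at level `m` is `𝔽₄[s̄]/(s̄^{e'}) ⊂ 𝔽₄[t̄]/(t̄^e)` with `s̄ = ∏_{u∈±G}[u]t̄` of `t̄`-order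
`d = 2^{m+1}` and `e = e'·d = 3·4^m`; the "digits" of `Z` are the coefficients of the polynomial `P` (`deg P < e'`) with
`Z ≡ P(s̄) (mod t̄^e)`, and S1 (iv) reads: «squares in `𝔽₄[s̄]/(s̄^{e'})` are exactly the even-digit elements, so
`OddDigit(m) ⟹ ζ^ρ_{m−1} ∉ (M^×_{m−1,𝔓})²`».  Abstractly, over an integral domain `k`, for `s ∈ k⟦t⟧` of order `d ≥ 1`:

* `order_aeval_eq` — `ord R(s) = d · (X-adic valuation of R)` in the form `R = X^i·R₁`, `R₁(0) ≠ 0 ⟹ ord R(s) = i·d`;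
  `not_X_pow_dvd_aeval` — `R ≠ 0`, `deg R < e' ⟹ t^{e'd} ∤ R(s)`;
* **`digits_unique`** — `deg P, deg P̃ < e'`, `P(s) ≡ P̃(s) (mod t^{e'd}) ⟹ P = P̃` (the digits are well defined);
* `X_pow_dvd_aeval_of_forall_coeff_eq_zero` — a polynomial with no terms below degree `e'` has `t^{e'd} ∣ R(s)`;
* **`forall_odd_coeff_eq_zero_of_sq`** (characteristic `2`) — if `Z ≡ P(s)` and `Z ≡ Q(s)²` `(mod t^{e'd})` with
  `deg P < e'`, then every odd-degree coefficient of `P` vanishes (`Q(s)² = Σ qᵢ² s^{2i}`, truncate below `e'`, compare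
  digits); contrapositive **`not_sq_of_oddDigit`**: an odd non-zero digit ⟹ `Z` is NOT a square of an element of `k[s]`
  modulo `t^{e'd}` — the algebraic half of S1 (iv) (the other half, `E^× = lim M^×_{n,𝔓}` and compactness, is
  field-of-norms theory, not here).

[folklore]
-/

noncomputable section

set_option autoImplicit false
set_option linter.dupNamespace false

open PowerSeries Polynomial

namespace Summit.BirchSwinnertonDyer.BirchSwinnertonDyer.Theorems.SignedMuAtTwo.Tilt

variable {k : Type*} [CommRing k] [IsDomain k]

omit [IsDomain k] in
/-- The constant term of `R(s)` is `R(s(0))`; for `s(0) = 0` it is `R.coeff 0`. [folklore] -/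
theorem constantCoeff_aeval (s : PowerSeries k) (hs : PowerSeries.constantCoeff s = 0) (R : k[X]) :
    PowerSeries.constantCoeff (aeval s R) = R.coeff 0 := by
  rw [Polynomial.aeval_def, Polynomial.hom_eval₂, hs, Polynomial.coeff_zero_eq_eval_zero, Polynomial.eval]
  congr 1

/-- **The order of `R(s)`**: if `ord s = d` and `R = X^i · R₁` with `R₁(0) ≠ 0`, then `ord R(s) = i·d`. [folklore] -/
theorem order_aeval_eq {s : PowerSeries k} {d : ℕ} (hd : 1 ≤ d) (hs : s.order = d) {R₁ : k[X]}
    (hR₁ : R₁.coeff 0 ≠ 0) (i : ℕ) :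
    (aeval s ((X : k[X]) ^ i * R₁)).order = (i * d : ℕ) := by
  have hs0 : PowerSeries.constantCoeff s = 0 := by
    have := coeff_of_lt_order (φ := s) 0 (by rw [hs]; exact_mod_cast hd)
    rwa [coeff_zero_eq_constantCoeff_apply] at this
  have h0 : (aeval s R₁).order = 0 := by
    have h : (aeval s R₁).order = ((0 : ℕ) : ℕ∞) := by
      rw [order_eq_nat]
      refine ⟨?_, fun i hi => absurd hi (Nat.not_lt_zero _)⟩
      rw [coeff_zero_eq_constantCoeff_apply, constantCoeff_aeval s hs0]
      exact hR₁
    simpa using h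
  rw [map_mul, map_pow, Polynomial.aeval_X, order_mul, order_pow, hs, h0, add_zero]
  simp

/-- `t^{e'd} ∤ R(s)` for `R ≠ 0` of degree `< e'` (`ord s = d ≥ 1`). [folklore] -/
theorem not_X_pow_dvd_aeval {s : PowerSeries k} {d : ℕ} (hd : 1 ≤ d) (hs : s.order = d) {e' : ℕ}
    {R : k[X]} (hR : R ≠ 0) (hdeg : R.natDegree < e') :
    ¬ (PowerSeries.X : PowerSeries k) ^ (e' * d) ∣ aeval s R := by
  -- `R = X^i · R₁`, `R₁(0) ≠ 0`, `i ≤ deg R`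
  obtain ⟨R₁, hR, hndvd⟩ := R.exists_eq_pow_rootMultiplicity_mul_and_not_dvd hR 0
  rw [map_zero, sub_zero] at hR hndvd
  set i := R.rootMultiplicity 0 with hi
  have hR₁c : R₁.coeff 0 ≠ 0 := fun h => hndvd (Polynomial.X_dvd_iff.mpr h)
  have hR₁0 : R₁ ≠ 0 := fun h => hR₁c (by rw [h, Polynomial.coeff_zero])
  have hideg : i ≤ R.natDegree := by
    conv_rhs => rw [hR]
    rw [Polynomial.natDegree_mul (pow_ne_zero _ Polynomial.X_ne_zero) hR₁0, Polynomial.natDegree_X_pow]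
    exact Nat.le_add_right _ _
  intro hdvd
  have hord : ((e' * d : ℕ) : ℕ∞) ≤ (aeval s R).order :=
    nat_le_order _ _ ((PowerSeries.X_pow_dvd_iff).mp hdvd)
  rw [hR, order_aeval_eq hd hs hR₁c i] at hord
  have : e' * d ≤ i * d := by exact_mod_cast hord
  have := Nat.le_of_mul_le_mul_right this (by omega)
  omega

/-- **Digits are well defined**: two polynomials of degree `< e'` with `P(s) ≡ P̃(s) (mod t^{e'd})` are equal
(`ord s = d ≥ 1`, `k` a domain). [folklore] -/
theorem digits_unique {s : PowerSeries k} {d : ℕ} (hd : 1 ≤ d) (hs : s.order = d) {e' : ℕ} {P P' : k[X]}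
    (hP : P.natDegree < e') (hP' : P'.natDegree < e')
    (h : (PowerSeries.X : PowerSeries k) ^ (e' * d) ∣ aeval s P - aeval s P') : P = P' := by
  by_contra hne
  have hR : P - P' ≠ 0 := sub_ne_zero.mpr hne
  have hdeg : (P - P').natDegree < e' :=
    lt_of_le_of_lt (Polynomial.natDegree_sub_le P P') (max_lt hP hP')
  exact not_X_pow_dvd_aeval hd hs hR hdeg (by rwa [map_sub])

omit [IsDomain k] in
/-- A polynomial with no terms of degree `< e'` evaluates into `(t^{e'd})` (`ord s ≥ d`). [folklore] -/
theorem X_pow_dvd_aeval_of_forall_coeff_eq_zero {s : PowerSeries k} {d : ℕ} (hs : (d : ℕ∞) ≤ s.order) {e' : ℕ}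
    {R : k[X]} (hR : ∀ n < e', R.coeff n = 0) :
    (PowerSeries.X : PowerSeries k) ^ (e' * d) ∣ aeval s R := by
  obtain ⟨T, hT⟩ := (Polynomial.X_pow_dvd_iff).mpr hR
  rw [hT, map_mul, map_pow, Polynomial.aeval_X]
  refine Dvd.dvd.mul_right ?_ _
  refine (PowerSeries.X_pow_dvd_iff).mpr fun m hm => coeff_of_lt_order m (lt_of_lt_of_le ?_ (le_order_pow _ _))
  calc (m : ℕ∞) < (e' * d : ℕ) := by exact_mod_cast hm
    _ = e' • (d : ℕ∞) := by push_cast; rw [nsmul_eq_mul]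
    _ ≤ e' • s.order := nsmul_le_nsmul_right hs _

/-! ## Squares have even digits (characteristic `2`) -/

/-- **An odd digit obstructs being a square** (S1 (iv), algebraic half).  `k` a domain of characteristic `2`,
`ord s = d ≥ 1`, `deg P < e'`: if `Z ≡ P(s)` and `Z ≡ Q(s)²` modulo `t^{e'd}` for some polynomial `Q`, then all
odd-degree coefficients of `P` vanish.  (`Q(s)² = Σ qᵢ² s^{2i}`; its part below degree `e'` has even digits only and
the rest lies in `(t^{e'd})`; digits are unique.) [folklore] -/
theorem forall_odd_coeff_eq_zero_of_sq [CharP k 2] {s : PowerSeries k} {d : ℕ} (hd : 1 ≤ d) (hs : s.order = d)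
    {e' : ℕ} {Z : PowerSeries k} {P Q : k[X]} (hP : P.natDegree < e')
    (hZP : (PowerSeries.X : PowerSeries k) ^ (e' * d) ∣ Z - aeval s P)
    (hZQ : (PowerSeries.X : PowerSeries k) ^ (e' * d) ∣ Z - (aeval s Q) ^ 2) :
    ∀ n, Odd n → P.coeff n = 0 := by
  classical
  -- `Q² = expand 2 (Q.map frob)`: only even-degree coefficients
  set R : k[X] := Q ^ 2 with hRdef
  have hReven : ∀ n, Odd n → R.coeff n = 0 := by
    intro n hn
    have hR : R = expand k 2 (Q.map (frobenius k 2)) := by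
      rw [hRdef, ← Polynomial.map_expand, Polynomial.map_frobenius_expand]
    rw [hR, Polynomial.coeff_expand (by norm_num)]
    rw [if_neg (fun h2 => (Nat.not_even_iff_odd.mpr hn) (even_iff_two_dvd.mpr h2))]
  -- the truncation of `R` below degree `e'`
  set Rlo : k[X] := ∑ n ∈ Finset.range e', Polynomial.C (R.coeff n) * Polynomial.X ^ n with hRlo
  have hRlo_coeff : ∀ n, Rlo.coeff n = if n < e' then R.coeff n else 0 := by
    intro n
    rw [hRlo, Polynomial.finsetSum_coeff]
    simp only [Polynomial.coeff_C_mul_X_pow]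
    rw [Finset.sum_ite_eq (Finset.range e') n (fun x => R.coeff x)]
    simp [Finset.mem_range]
  have hRlo_deg : Rlo.natDegree < e' ∨ Rlo = 0 := by
    by_cases h0 : Rlo = 0
    · exact Or.inr h0
    · left
      rw [Polynomial.natDegree_lt_iff_degree_lt h0, Polynomial.degree_lt_iff_coeff_zero]
      intro m hm
      rw [hRlo_coeff, if_neg (by omega)]
  have hhi : (PowerSeries.X : PowerSeries k) ^ (e' * d) ∣ aeval s (R - Rlo) :=
    X_pow_dvd_aeval_of_forall_coeff_eq_zero hs.ge fun n hn => by
      rw [Polynomial.coeff_sub, hRlo_coeff, if_pos hn, sub_self]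
  -- `P(s) ≡ Rlo(s)`: hence `P = Rlo`
  have hPR : (PowerSeries.X : PowerSeries k) ^ (e' * d) ∣ aeval s P - aeval s Rlo := by
    have e1 : aeval s P - aeval s Rlo = (Z - (aeval s Q) ^ 2) - (Z - aeval s P) + aeval s (R - Rlo) := by
      rw [map_sub, hRdef, map_pow]; ring
    rw [e1]
    exact dvd_add (dvd_sub hZQ hZP) hhi
  have hPeq : P = Rlo := by
    rcases hRlo_deg with hlt | h0
    · exact digits_unique hd hs hP hlt hPR
    · rw [h0, map_zero, sub_zero] at hPR
      by_contra hP0'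
      have hP0 : P ≠ 0 := fun h => hP0' (by rw [h, h0])
      exact not_X_pow_dvd_aeval hd hs hP0 hP hPR
  intro n hn
  rw [hPeq, hRlo_coeff]
  split_ifs
  · exact hReven n hn
  · rfl

/-- **`OddDigit ⟹ not a square in the bottom ring`** (contrapositive form used by the line): `k` a domain of
characteristic `2`, `ord s = d ≥ 1`, `Z ≡ P(s) (mod t^{e'd})` with `deg P < e'` and some odd-degree coefficient of
`P` non-zero ⟹ there is NO polynomial `Q` with `Z ≡ Q(s)² (mod t^{e'd})`. [folklore] -/
theorem not_sq_of_oddDigit [CharP k 2] {s : PowerSeries k} {d : ℕ} (hd : 1 ≤ d) (hs : s.order = d)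
    {e' : ℕ} {Z : PowerSeries k} {P : k[X]} (hP : P.natDegree < e')
    (hZP : (PowerSeries.X : PowerSeries k) ^ (e' * d) ∣ Z - aeval s P) (hodd : ∃ n, Odd n ∧ P.coeff n ≠ 0) :
    ¬ ∃ Q : k[X], (PowerSeries.X : PowerSeries k) ^ (e' * d) ∣ Z - (aeval s Q) ^ 2 := by
  rintro ⟨Q, hQ⟩
  obtain ⟨n, hn, hPn⟩ := hodd
  exact hPn (forall_odd_coeff_eq_zero_of_sq hd hs hP hZP hQ n hn)

end Summit.BirchSwinnertonDyer.BirchSwinnertonDyer.Theorems.SignedMuAtTwo.Tilt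

end
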